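import Mathlib
import HarnessLib
import Literature.Probability.LatticeModels.SlitPlaneAsymptotics

/-!
# The polar coefficients of the two seed classes in the Hermite limit: `√(3/8)` (even) and `√(5/8)` (odd)

Helper file (`--supports stmt-RiemannHypothesis-0098`), elementary real analysis (Gaussian moments), no definitions.  Seat
rh-explicit-weil-5 gen14 (file of record `HOME/rh-explicit-weil-5/WEIL5-CLASS.md` §1).

Context (documentation only).  The interior of every certified even | odd section of the compressed Weil form is the POLE-KILLING
seed of its prolate class, `ψ₄ − β_e(c)ψ₀` | `ψ₆ − β_o(c)ψ₂` with `β = ∫₀¹ψ_hi/∫₀¹ψ_lo` (the seed's Mellin transform vanishes at ζ's pole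
`s = 1`, cf. `Theorems/WeilTransportMellinDiagonal.transport_mellin_sum_at_one_of_mass_zero`).  As `c → ∞` the prolates `ψ_n(c; v)`
become Hermite functions `h_n(x) = H_n(x) e^{−x²/2}/√(2ⁿ n!)` in `x = √c·v`, and `β_e(c) → ∫h₄/∫h₀`, `β_o(c) → ∫h₆/∫h₂` (measured:
`0.6119`, `0.7899` at `c = 933`).  In the variable `y = x/√2` (weight `e^{−y²}`) the physicists' Hermite polynomials read
`H₀ = 1`, `H₂(√2y) = 8y² − 2`, `H₄(√2y) = 64y⁴ − 96y² + 12`, `H₆(√2y) = 512y⁶ − 1920y⁴ + 1440y² − 120`, and this file proves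

* `gaussMoment_even`        : `∫_{(0,∞)} y^{2k} e^{−y²} dy = Γ(k + ½)/2`;
* `Gamma_five_halves`, `Gamma_seven_halves` : `Γ(5/2) = 3√π/4`, `Γ(7/2) = 15√π/8`;
* `integral_hermite0/2/4/6` : `∫_{(0,∞)} H_n(√2 y) e^{−y²} dy = √π/2, √π, 6√π, 60√π` (`n = 0, 2, 4, 6`);
* `polarCoeff_even_hermiteLimit` : `(6√π/√384)/(√π/2) = √(3/8)`   — the even class (`= 0.6124`; Connes–Consani–Moscovici
  arXiv:2511.22755 (7.4): `h = (√3/2^{11/4}) h₄ − (3/2^{17/4}) h₀`, the combination of `h₀, h₄` with vanishing integral);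
* `polarCoeff_odd_hermiteLimit`  : `(60√π/√46080)/(√π/√8) = √(5/8)`  — the odd class (`= 0.7906`; new in gen14).

Standard axioms only; no `sorry`.
-/

set_option linter.dupNamespace false
set_option autoImplicit false

noncomputable section

open Real MeasureTheory Set

namespace Summit.RiemannHypothesis.RiemannHypothesis.Theorems.WeilPolarHermiteLimits

/-- Even Gaussian moments on the half line: `∫_{(0,∞)} y^{2k} e^{−y²} dy = Γ(k + ½)/2`. -/
theorem gaussMoment_even (k : ℕ) :
    ∫ y in Ioi (0 : ℝ), y ^ (2 * k) * Real.exp (-y ^ 2) = Real.Gamma (k + 1 / 2) / 2 := by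
  have h := Literature.Probability.LatticeModels.integral_pow_mul_exp_neg_mul_sq (2 * k) (b := 1) one_pos
  simp only [one_mul, neg_mul] at h ⊢
  rw [show (fun y : ℝ => y ^ (2 * k) * Real.exp (-y ^ 2)) = fun y => y ^ (2 * k) * Real.exp (-(1 * y ^ 2)) by
    funext y; rw [one_mul]] at *
  rw [h, Real.one_rpow]
  push_cast
  ring_nf

/-- `Γ(5/2) = 3√π/4`. -/
theorem Gamma_five_halves : Real.Gamma (5 / 2) = 3 * Real.sqrt π / 4 := by
  rw [show (5 / 2 : ℝ) = 3 / 2 + 1 by norm_num, Real.Gamma_add_one (by norm_num),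
    Literature.Probability.LatticeModels.Real_Gamma_three_halves]
  ring

/-- `Γ(7/2) = 15√π/8`. -/
theorem Gamma_seven_halves : Real.Gamma (7 / 2) = 15 * Real.sqrt π / 8 := by
  rw [show (7 / 2 : ℝ) = 5 / 2 + 1 by norm_num, Real.Gamma_add_one (by norm_num), Gamma_five_halves]
  ring

/-- `∫_{(0,∞)} e^{−y²} = √π/2`. -/
theorem gaussMoment_zero : ∫ y in Ioi (0 : ℝ), Real.exp (-y ^ 2) = Real.sqrt π / 2 := by
  have h := gaussMoment_even 0
  simp only [Nat.cast_zero, mul_zero, pow_zero, one_mul, zero_add] at h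
  rw [h, Real.Gamma_one_half_eq]

/-- `∫_{(0,∞)} y² e^{−y²} = √π/4`. -/
theorem gaussMoment_two : ∫ y in Ioi (0 : ℝ), y ^ 2 * Real.exp (-y ^ 2) = Real.sqrt π / 4 := by
  have h := gaussMoment_even 1
  simp only [Nat.cast_one, mul_one] at h
  rw [h, show (1 : ℝ) + 1 / 2 = 3 / 2 by norm_num, Literature.Probability.LatticeModels.Real_Gamma_three_halves]
  ring

/-- `∫_{(0,∞)} y⁴ e^{−y²} = 3√π/8`. -/
theorem gaussMoment_four : ∫ y in Ioi (0 : ℝ), y ^ 4 * Real.exp (-y ^ 2) = 3 * Real.sqrt π / 8 := by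
  have h := gaussMoment_even 2
  simp only [Nat.cast_ofNat] at h
  rw [show 2 * 2 = 4 by norm_num] at h
  rw [h, show (2 : ℝ) + 1 / 2 = 5 / 2 by norm_num, Gamma_five_halves]
  ring

/-- `∫_{(0,∞)} y⁶ e^{−y²} = 15√π/16`. -/
theorem gaussMoment_six : ∫ y in Ioi (0 : ℝ), y ^ 6 * Real.exp (-y ^ 2) = 15 * Real.sqrt π / 16 := by
  have h := gaussMoment_even 3
  simp only [Nat.cast_ofNat] at h
  rw [show 2 * 3 = 6 by norm_num] at h
  rw [h, show (3 : ℝ) + 1 / 2 = 7 / 2 by norm_num, Gamma_seven_halves]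
  ring

/-- integrability of the monomial Gaussians on the half line (for splitting the polynomial integrals) -/
theorem integrableOn_pow_gauss (n : ℕ) : IntegrableOn (fun y : ℝ => y ^ n * Real.exp (-y ^ 2)) (Ioi 0) := by
  have h := Literature.Probability.LatticeModels.integrableOn_pow_mul_exp_neg_mul_sq n (b := 1) one_pos
  refine h.congr_fun (fun y _ => ?_) measurableSet_Ioi
  simp

/-- `∫_{(0,∞)} H₀ e^{−y²} = √π/2`. -/
theorem integral_hermite0 : ∫ y in Ioi (0 : ℝ), (1 : ℝ) * Real.exp (-y ^ 2) = Real.sqrt π / 2 := by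
  simp only [one_mul]; exact gaussMoment_zero

/-- `∫_{(0,∞)} H₂(√2 y) e^{−y²} dy = ∫ (8y² − 2) e^{−y²} = √π`. -/
theorem integral_hermite2 : ∫ y in Ioi (0 : ℝ), (8 * y ^ 2 - 2) * Real.exp (-y ^ 2) = Real.sqrt π := by
  have e : (fun y : ℝ => (8 * y ^ 2 - 2) * Real.exp (-y ^ 2))
      = fun y => 8 * (y ^ 2 * Real.exp (-y ^ 2)) - 2 * (y ^ 0 * Real.exp (-y ^ 2)) := by
    funext y; ring
  rw [e, integral_sub ((integrableOn_pow_gauss 2).const_mul 8) ((integrableOn_pow_gauss 0).const_mul 2),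
    integral_const_mul, integral_const_mul, gaussMoment_two]
  simp only [pow_zero, one_mul]
  rw [gaussMoment_zero]; ring

/-- `∫_{(0,∞)} H₄(√2 y) e^{−y²} dy = ∫ (64y⁴ − 96y² + 12) e^{−y²} = 6√π`. -/
theorem integral_hermite4 :
    ∫ y in Ioi (0 : ℝ), (64 * y ^ 4 - 96 * y ^ 2 + 12) * Real.exp (-y ^ 2) = 6 * Real.sqrt π := by
  have i4 : Integrable (fun y : ℝ => 64 * (y ^ 4 * Real.exp (-y ^ 2))) (volume.restrict (Ioi 0)) :=
    (integrableOn_pow_gauss 4).const_mul 64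
  have i2 : Integrable (fun y : ℝ => 96 * (y ^ 2 * Real.exp (-y ^ 2))) (volume.restrict (Ioi 0)) :=
    (integrableOn_pow_gauss 2).const_mul 96
  have i0 : Integrable (fun y : ℝ => 12 * Real.exp (-y ^ 2)) (volume.restrict (Ioi 0)) := by
    have := (integrableOn_pow_gauss 0).const_mul 12
    refine this.congr ?_
    filter_upwards with y; simp
  have e : (fun y : ℝ => (64 * y ^ 4 - 96 * y ^ 2 + 12) * Real.exp (-y ^ 2))
      = fun y => (64 * (y ^ 4 * Real.exp (-y ^ 2)) - 96 * (y ^ 2 * Real.exp (-y ^ 2))) + 12 * Real.exp (-y ^ 2) := by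
    funext y; ring
  have s1 : ∫ y in Ioi (0 : ℝ), (64 * (y ^ 4 * Real.exp (-y ^ 2)) - 96 * (y ^ 2 * Real.exp (-y ^ 2))) + 12 * Real.exp (-y ^ 2)
      = (∫ y in Ioi (0 : ℝ), 64 * (y ^ 4 * Real.exp (-y ^ 2)) - 96 * (y ^ 2 * Real.exp (-y ^ 2)))
        + ∫ y in Ioi (0 : ℝ), 12 * Real.exp (-y ^ 2) := integral_add (i4.sub i2) i0
  have s2 : ∫ y in Ioi (0 : ℝ), 64 * (y ^ 4 * Real.exp (-y ^ 2)) - 96 * (y ^ 2 * Real.exp (-y ^ 2))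
      = (∫ y in Ioi (0 : ℝ), 64 * (y ^ 4 * Real.exp (-y ^ 2))) - ∫ y in Ioi (0 : ℝ), 96 * (y ^ 2 * Real.exp (-y ^ 2)) :=
    integral_sub i4 i2
  rw [e, s1, s2, integral_const_mul, integral_const_mul, integral_const_mul, gaussMoment_four, gaussMoment_two,
    gaussMoment_zero]
  ring

/-- `∫_{(0,∞)} H₆(√2 y) e^{−y²} dy = ∫ (512y⁶ − 1920y⁴ + 1440y² − 120) e^{−y²} = 60√π`. -/
theorem integral_hermite6 :
    ∫ y in Ioi (0 : ℝ), (512 * y ^ 6 - 1920 * y ^ 4 + 1440 * y ^ 2 - 120) * Real.exp (-y ^ 2) = 60 * Real.sqrt π := by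
  have i6 : Integrable (fun y : ℝ => 512 * (y ^ 6 * Real.exp (-y ^ 2))) (volume.restrict (Ioi 0)) :=
    (integrableOn_pow_gauss 6).const_mul 512
  have i4 : Integrable (fun y : ℝ => 1920 * (y ^ 4 * Real.exp (-y ^ 2))) (volume.restrict (Ioi 0)) :=
    (integrableOn_pow_gauss 4).const_mul 1920
  have i2 : Integrable (fun y : ℝ => 1440 * (y ^ 2 * Real.exp (-y ^ 2))) (volume.restrict (Ioi 0)) :=
    (integrableOn_pow_gauss 2).const_mul 1440
  have i0 : Integrable (fun y : ℝ => 120 * Real.exp (-y ^ 2)) (volume.restrict (Ioi 0)) := by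
    have := (integrableOn_pow_gauss 0).const_mul 120
    refine this.congr ?_
    filter_upwards with y; simp
  have e : (fun y : ℝ => (512 * y ^ 6 - 1920 * y ^ 4 + 1440 * y ^ 2 - 120) * Real.exp (-y ^ 2))
      = fun y => ((512 * (y ^ 6 * Real.exp (-y ^ 2)) - 1920 * (y ^ 4 * Real.exp (-y ^ 2)))
          + 1440 * (y ^ 2 * Real.exp (-y ^ 2))) - 120 * Real.exp (-y ^ 2) := by
    funext y; ring
  have s1 : ∫ y in Ioi (0 : ℝ), ((512 * (y ^ 6 * Real.exp (-y ^ 2)) - 1920 * (y ^ 4 * Real.exp (-y ^ 2)))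
          + 1440 * (y ^ 2 * Real.exp (-y ^ 2))) - 120 * Real.exp (-y ^ 2)
      = (∫ y in Ioi (0 : ℝ), (512 * (y ^ 6 * Real.exp (-y ^ 2)) - 1920 * (y ^ 4 * Real.exp (-y ^ 2)))
          + 1440 * (y ^ 2 * Real.exp (-y ^ 2))) - ∫ y in Ioi (0 : ℝ), 120 * Real.exp (-y ^ 2) :=
    integral_sub ((i6.sub i4).add i2) i0
  have s2 : ∫ y in Ioi (0 : ℝ), (512 * (y ^ 6 * Real.exp (-y ^ 2)) - 1920 * (y ^ 4 * Real.exp (-y ^ 2)))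
          + 1440 * (y ^ 2 * Real.exp (-y ^ 2))
      = (∫ y in Ioi (0 : ℝ), 512 * (y ^ 6 * Real.exp (-y ^ 2)) - 1920 * (y ^ 4 * Real.exp (-y ^ 2)))
          + ∫ y in Ioi (0 : ℝ), 1440 * (y ^ 2 * Real.exp (-y ^ 2)) := integral_add (i6.sub i4) i2
  have s3 : ∫ y in Ioi (0 : ℝ), 512 * (y ^ 6 * Real.exp (-y ^ 2)) - 1920 * (y ^ 4 * Real.exp (-y ^ 2))
      = (∫ y in Ioi (0 : ℝ), 512 * (y ^ 6 * Real.exp (-y ^ 2))) - ∫ y in Ioi (0 : ℝ), 1920 * (y ^ 4 * Real.exp (-y ^ 2)) :=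
    integral_sub i6 i4
  rw [e, s1, s2, s3, integral_const_mul, integral_const_mul, integral_const_mul, integral_const_mul,
    gaussMoment_six, gaussMoment_four, gaussMoment_two, gaussMoment_zero]
  ring

/-- THE EVEN CLASS: `β_e(∞) = (∫h₄)/(∫h₀) = (6√π/√(2⁴·4!))/(√π/2) = √(3/8)` (`= 0.6124`; the cell's seeds read `0.599 … 0.612`
for `c = 38 … 933`). -/
theorem polarCoeff_even_hermiteLimit :
    (6 * Real.sqrt π / Real.sqrt 384) / (Real.sqrt π / 2) = Real.sqrt (3 / 8) := by
  have hpi : 0 < Real.sqrt π := Real.sqrt_pos.mpr Real.pi_pos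
  have h384 : Real.sqrt 384 = 8 * Real.sqrt 6 := by
    rw [show (384 : ℝ) = 8 ^ 2 * 6 by norm_num, Real.sqrt_mul (by norm_num), Real.sqrt_sq (by norm_num)]
  have h38 : Real.sqrt (3 / 8) = Real.sqrt 6 / 4 := by
    rw [show (3 / 8 : ℝ) = 6 / 4 ^ 2 by norm_num, Real.sqrt_div (by norm_num), Real.sqrt_sq (by norm_num)]
  have h6 : 0 < Real.sqrt 6 := Real.sqrt_pos.mpr (by norm_num)
  have h6sq : Real.sqrt 6 ^ 2 = 6 := Real.sq_sqrt (by norm_num)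
  rw [h384, h38]
  field_simp
  nlinarith [h6sq]

/-- THE ODD CLASS: `β_o(∞) = (∫h₆)/(∫h₂) = (60√π/√(2⁶·6!))/(√π/√(2²·2!)) = √(5/8)` (`= 0.7906`; the cell's odd sections read
`0.772 … 0.790` for `c = 38 … 933`). -/
theorem polarCoeff_odd_hermiteLimit :
    (60 * Real.sqrt π / Real.sqrt 46080) / (Real.sqrt π / Real.sqrt 8) = Real.sqrt (5 / 8) := by
  have hpi : 0 < Real.sqrt π := Real.sqrt_pos.mpr Real.pi_pos
  have h46080 : Real.sqrt 46080 = 96 * Real.sqrt 5 := by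
    rw [show (46080 : ℝ) = 96 ^ 2 * 5 by norm_num, Real.sqrt_mul (by norm_num), Real.sqrt_sq (by norm_num)]
  have h8 : Real.sqrt 8 = 2 * Real.sqrt 2 := by
    rw [show (8 : ℝ) = 2 ^ 2 * 2 by norm_num, Real.sqrt_mul (by norm_num), Real.sqrt_sq (by norm_num)]
  have h58 : Real.sqrt (5 / 8) = Real.sqrt 5 * Real.sqrt 2 / 4 := by
    rw [show (5 / 8 : ℝ) = 5 * 2 / 4 ^ 2 by norm_num, Real.sqrt_div (by norm_num), Real.sqrt_sq (by norm_num),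
      Real.sqrt_mul (by norm_num)]
  have h5 : 0 < Real.sqrt 5 := Real.sqrt_pos.mpr (by norm_num)
  have h2 : 0 < Real.sqrt 2 := Real.sqrt_pos.mpr (by norm_num)
  have h5sq : Real.sqrt 5 ^ 2 = 5 := Real.sq_sqrt (by norm_num)
  have h2sq : Real.sqrt 2 ^ 2 = 2 := Real.sq_sqrt (by norm_num)
  rw [h46080, h8, h58]
  field_simp
  nlinarith [h5sq, h2sq, mul_pos h5 h2]

end Summit.RiemannHypothesis.RiemannHypothesis.Theorems.WeilPolarHermiteLimits

end
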